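import Mathlib
import Summits.NavierStokesRegularity.FluidComputer.GalerkinLatticePhaseSpace
import Summits.NavierStokesRegularity.FluidComputer.LatticeBoxInterpolation
import HarnessLib

/-!
# Condition (C1) on the lattice `ℓ²` phase space: uniform continuity from an `H^t`-Lipschitz bound and uniform tails (instab g16, cell `ns-blowup`, 2026-08-27)

HONEST FRAMING (human ruling D-0035): nothing here is a claim about Navier–Stokes blow-up.
WHAT THIS IS NOT: not NS evidence — an `ε`–`δ` argument on Mathlib's `lp (fun _ : ℤ^d => V) 2`
composing `LatticeBoxInterpolation.eNormSq_sub_le_of_uniform_tail` (part IV) with the phase-space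
dictionary `GalerkinLatticePhaseSpace` (part V). No flow, set `W`, operator or certificate is
constructed; the map `Φ` is arbitrary.

PURPOSE (`HOME/instab/BETA2-SPEC.md` §4, condition (C1) = field `continuousOn` of
`Literature.Analysis.ODE.GalerkinConvergenceSetting`). A derivative-losing field `F` on the scaled
phase space `E` (coefficient families `⇑x`, `‖x‖² = ‖⇑x‖₀²`) is NOT Lipschitz in `‖·‖_E`, but it is
Lipschitz from a HIGHER lattice level `H^t` of the coefficients into `E` on the box `W` (parts I/III:
`t = 1` for the transport bilinearity read on scaled families, `t = 2` for the Laplacian). If `W`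
has UNIFORM `H^t`-tails — every polynomial box does — then `F` is uniformly continuous on `W`:

* `uniformContinuousOn_of_lipschitz_level` — `∀ ε > 0, ∃ δ > 0, ∀ x y ∈ W, ‖x − y‖ < δ →
  ‖Φ x − Φ y‖ < ε`, from `‖Φ x − Φ y‖² ≤ L² ‖⇑x − ⇑y‖ₜ²` on `W` and uniform `H^t`-tails of `W`;
* `continuousOn_of_lipschitz_level` — hence `ContinuousOn Φ W` (the (C1) field).
-/

noncomputable section

namespace Summit.NavierStokesRegularity.FluidComputer.GalerkinLatticeContinuity

open Set Finset Filter Topology Metric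
open Literature.Analysis.FunctionSpaces Literature.Analysis.FunctionSpaces.Lattice
open Literature.Analysis.FunctionSpaces.Torus Literature.Analysis.ODE
open Summit.NavierStokesRegularity.FluidComputer.GalerkinLatticePhaseSpace
open Summit.NavierStokesRegularity.FluidComputer.LatticeBoxInterpolation
open scoped ENNReal NNReal

variable {d : Type*} [Fintype d]
variable {V : Type*} [NormedAddCommGroup V]

/-- **Uniform continuity on a set with uniform `H^t`-tails from an `H^t`-Lipschitz bound.** Let
`Φ : E → E` on `E = lp (fun _ : ℤ^d => V) 2` satisfy `‖Φ x − Φ y‖² ≤ L² · ‖⇑x − ⇑y‖ₜ²` for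
`x, y ∈ W` (the lattice `H^t` norm of the DIFFERENCE of the coefficient families; read in `ℝ`, so an
infinite norm makes the hypothesis say `Φ x = Φ y`), and let
`W` have uniform `H^t`-tails: for every `τ > 0` a finite `K` with `‖⇑x − 𝟙_K ⇑x‖ₜ² ≤ τ` for all
`x ∈ W`. Then for every `ε > 0` there is `δ > 0` with `‖Φ x − Φ y‖ < ε` whenever `x, y ∈ W`,
`‖x − y‖ < δ`. -/
theorem uniformContinuousOn_of_lipschitz_level {W : Set (lp (fun _ : (d → ℤ) => V) 2)}
    {Φ : lp (fun _ : (d → ℤ) => V) 2 → lp (fun _ : (d → ℤ) => V) 2} {L t : ℝ}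
    (hLip : ∀ x ∈ W, ∀ y ∈ W,
      ‖Φ x - Φ y‖ ^ 2 ≤ L ^ 2 * (eNormSq t (⇑x - ⇑y)).toReal)
    (htail : ∀ τ : ℝ, 0 < τ → ∃ K : Finset (d → ℤ), ∀ x ∈ W,
      eNormSq t (⇑x - trunc K ⇑x) ≤ ENNReal.ofReal τ) :
    ∀ ε : ℝ, 0 < ε → ∃ δ : ℝ, 0 < δ ∧ ∀ x ∈ W, ∀ y ∈ W, ‖x - y‖ < δ → ‖Φ x - Φ y‖ < ε := by
  intro ε hε
  -- tails: `4 L² τ ≤ ε²/2`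
  set τ : ℝ := ε ^ 2 / (8 * (L ^ 2 + 1)) with hτ
  have hL1 : 0 < L ^ 2 + 1 := by positivity
  have hτ0 : 0 < τ := by rw [hτ]; positivity
  obtain ⟨K, hK⟩ := htail τ hτ0
  -- the weight bound on `K`
  set R : ℝ := ∑ k ∈ K, sobolevWeight t k + 1 with hR
  have hR0 : 0 < R := by
    rw [hR]; exact add_pos_of_nonneg_of_pos (Finset.sum_nonneg fun k _ => (sobolevWeight_pos t k).le) one_pos
  have hKR : ∀ k ∈ K, sobolevWeight (t - 0) k ≤ R := fun k hk => by
    rw [sub_zero, hR]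
    have := Finset.single_le_sum (f := fun k => sobolevWeight t k)
      (fun k _ => (sobolevWeight_pos t k).le) hk
    linarith
  -- `δ` with `L² R² δ² ≤ ε²/4`
  refine ⟨ε / (2 * (|L| * R + 1)), by positivity, fun x hx y hy hxy => ?_⟩
  have hLR : 0 < |L| * R + 1 := by positivity
  -- the interpolation inequality for the difference, read in `ℝ`
  have hxyfin : eNormSq 0 (⇑x - ⇑y) < ∞ := by
    have := eNormSq_zero_coe_lt_top (x - y)
    rwa [lp.coeFn_sub] at this
  have hint : (eNormSq t (⇑x - ⇑y)).toReal ≤ R ^ 2 * ‖x - y‖ ^ 2 + 4 * τ := by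
    have h := eNormSq_sub_le_of_uniform_tail (s := 0) (t := t) hKR (hK x hx) (hK y hy)
    have hne : ENNReal.ofReal (R ^ 2) * eNormSq 0 (⇑x - ⇑y) + 4 * ENNReal.ofReal τ ≠ ∞ :=
      ENNReal.add_ne_top.2 ⟨ENNReal.mul_ne_top ENNReal.ofReal_ne_top hxyfin.ne,
        ENNReal.mul_ne_top (by norm_num) ENNReal.ofReal_ne_top⟩
    have h' := ENNReal.toReal_mono hne h
    rw [ENNReal.toReal_add (ENNReal.mul_ne_top ENNReal.ofReal_ne_top hxyfin.ne)
        (ENNReal.mul_ne_top (by norm_num) ENNReal.ofReal_ne_top),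
      ENNReal.toReal_mul, ENNReal.toReal_mul, ENNReal.toReal_ofReal (sq_nonneg _),
      ENNReal.toReal_ofReal hτ0.le, show (4 : ℝ≥0∞).toReal = 4 by norm_num] at h'
    have hnorm : (eNormSq 0 (⇑x - ⇑y)).toReal = ‖x - y‖ ^ 2 := by
      rw [norm_sq_eq_toReal_eNormSq_zero, lp.coeFn_sub]
    rwa [hnorm] at h'
  -- assemble
  have h1 : ‖Φ x - Φ y‖ ^ 2 ≤ L ^ 2 * (R ^ 2 * ‖x - y‖ ^ 2 + 4 * τ) :=
    (hLip x hx y hy).trans (mul_le_mul_of_nonneg_left hint (sq_nonneg L))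
  have h2 : L ^ 2 * (4 * τ) ≤ ε ^ 2 / 2 := by
    rw [hτ]
    have : L ^ 2 * (4 * (ε ^ 2 / (8 * (L ^ 2 + 1)))) = (L ^ 2 / (L ^ 2 + 1)) * (ε ^ 2 / 2) := by
      field_simp; ring
    rw [this]
    have hfrac : L ^ 2 / (L ^ 2 + 1) ≤ 1 := by
      rw [div_le_one hL1]; linarith
    exact (mul_le_mul_of_nonneg_right hfrac (by positivity)).trans (le_of_eq (one_mul _))
  have h3 : L ^ 2 * (R ^ 2 * ‖x - y‖ ^ 2) ≤ ε ^ 2 / 4 := by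
    have hxy' : ‖x - y‖ < ε / (2 * (|L| * R + 1)) := hxy
    have hn : 0 ≤ ‖x - y‖ := norm_nonneg _
    have hb : |L| * R * ‖x - y‖ ≤ ε / 2 := by
      have hstep : |L| * R * ‖x - y‖ ≤ (|L| * R + 1) * ‖x - y‖ :=
        mul_le_mul_of_nonneg_right (by linarith) hn
      have hstep2 : (|L| * R + 1) * ‖x - y‖ ≤ (|L| * R + 1) * (ε / (2 * (|L| * R + 1))) :=
        mul_le_mul_of_nonneg_left hxy'.le hLR.le
      have hstep3 : (|L| * R + 1) * (ε / (2 * (|L| * R + 1))) = ε / 2 := by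
        field_simp
      linarith
    have hsq : (|L| * R * ‖x - y‖) ^ 2 ≤ (ε / 2) ^ 2 :=
      pow_le_pow_left₀ (by positivity) hb 2
    have hid : L ^ 2 * (R ^ 2 * ‖x - y‖ ^ 2) = (|L| * R * ‖x - y‖) ^ 2 := by
      rw [mul_pow, mul_pow, sq_abs]; ring
    rw [hid]
    calc (|L| * R * ‖x - y‖) ^ 2 ≤ (ε / 2) ^ 2 := hsq
      _ = ε ^ 2 / 4 := by ring
  have h4 : ‖Φ x - Φ y‖ ^ 2 < ε ^ 2 := by
    have : ‖Φ x - Φ y‖ ^ 2 ≤ ε ^ 2 / 4 + ε ^ 2 / 2 := by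
      calc ‖Φ x - Φ y‖ ^ 2 ≤ L ^ 2 * (R ^ 2 * ‖x - y‖ ^ 2 + 4 * τ) := h1
        _ = L ^ 2 * (R ^ 2 * ‖x - y‖ ^ 2) + L ^ 2 * (4 * τ) := by ring
        _ ≤ ε ^ 2 / 4 + ε ^ 2 / 2 := add_le_add h3 h2
    have hε2 : ε ^ 2 / 4 + ε ^ 2 / 2 < ε ^ 2 := by nlinarith
    exact this.trans_lt hε2
  exact (abs_lt_of_sq_lt_sq' h4 hε.le).2

/-- **Condition (C1)**: under the hypotheses of `uniformContinuousOn_of_lipschitz_level`,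
`ContinuousOn Φ W`. -/
theorem continuousOn_of_lipschitz_level {W : Set (lp (fun _ : (d → ℤ) => V) 2)}
    {Φ : lp (fun _ : (d → ℤ) => V) 2 → lp (fun _ : (d → ℤ) => V) 2} {L t : ℝ}
    (hLip : ∀ x ∈ W, ∀ y ∈ W,
      ‖Φ x - Φ y‖ ^ 2 ≤ L ^ 2 * (eNormSq t (⇑x - ⇑y)).toReal)
    (htail : ∀ τ : ℝ, 0 < τ → ∃ K : Finset (d → ℤ), ∀ x ∈ W,
      eNormSq t (⇑x - trunc K ⇑x) ≤ ENNReal.ofReal τ) :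
    ContinuousOn Φ W := by
  rw [Metric.continuousOn_iff]
  intro x hx ε hε
  obtain ⟨δ, hδ, h⟩ := uniformContinuousOn_of_lipschitz_level hLip htail ε hε
  refine ⟨δ, hδ, fun y hy hyx => ?_⟩
  rw [dist_eq_norm] at hyx ⊢
  exact h y hy x hx hyx

end Summit.NavierStokesRegularity.FluidComputer.GalerkinLatticeContinuity

end
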